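import Literature.NumberTheory.ComplexMultiplication.CMTypeRankQuadraticSexticSlot
import HarnessLib

/-!
# A subfield of `ℂ` whose degree is not divisible by `8` contains at most two imaginary quadratic fields

Elementary Galois theory recorded for the census of products of CM abelian threefolds (cell `pub-hodgecm2`, COR-CM,
count-neutral own lane, seat b16): the Galois closure `L` of a sextic CM field `k·F` through an imaginary quadratic field
`k` has degree `6` or `12`, and the number of simple CM threefolds with pairwise non-isomorphic imaginary quadratic
subfields that ONE such closure can carry is bounded by the number of imaginary quadratic subfields of `L`:

* `finrank_sup_eq_four_of_ne` — two DIFFERENT quadratic subfields `Q₁ ≠ Q₂` of `ℂ` span a field of degree `4`;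
* `le_sup_of_not_eight_dvd` — a third quadratic `Q₃ ≤ L` lies in `Q₁ Q₂` as soon as `Q₁, Q₂ ≤ L` and `8 ∤ [L : ℚ]`
  (else `Q₁ Q₂ Q₃ ≤ L` has degree `8`);
* **`quadratic_eq_or_eq_or_eq_of_not_eight_dvd`** — three conjugation-stable quadratic subfields of `ℂ`, each moved by
  complex conjugation (IMAGINARY), inside a subfield `L` with `8 ∤ [L : ℚ]`: two of them coincide.  (In the biquadratic
  field `M = Q₁ Q₂`, Galois of degree `4`, the quadratic subfields are the fixed fields of the three elements of order `2`;
  complex conjugation is one of them and fixes a REAL quadratic field, so at most two quadratic subfields are imaginary.)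

Theorems only; no definition, no named fact, no `sorry`.

## References
* [Lang2002] S. Lang, *Algebra*, GTM 211, VI §1 Thm. 1.1, Cor. 1.6, Thm. 1.8 (Artin), Thm. 1.12; VI §1 Example
  (biquadratic extensions).
-/

noncomputable section

open IntermediateField NumberField Module

namespace Literature.NumberTheory.NumberFields

section Quadratic

/-- A subfield of a finite extension (inside `ℂ`) is finite. [folklore] -/
private theorem finiteDimensional_of_le₄₆ {E E' : IntermediateField ℚ ℂ} [FiniteDimensional ℚ E] (h : E' ≤ E) :
    FiniteDimensional ℚ E' :=
  FiniteDimensional.of_injective (IntermediateField.inclusion h).toLinearMap (IntermediateField.inclusion_injective h)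

/-- **Two different quadratic subfields of `ℂ` span a quartic field**: `[Q₁ Q₂ : ℚ]` is even, at most `4`, and not `2`.
[cite: Lang2002, VI §1 Cor. 1.6] -/
theorem finrank_sup_eq_four_of_ne {Q₁ Q₂ : IntermediateField ℚ ℂ} (h₁ : finrank ℚ Q₁ = 2) (h₂ : finrank ℚ Q₂ = 2)
    (hne : Q₁ ≠ Q₂) : finrank ℚ ↥(Q₁ ⊔ Q₂) = 4 := by
  haveI : FiniteDimensional ℚ Q₁ := Module.finite_of_finrank_pos (by rw [h₁]; norm_num)
  haveI : FiniteDimensional ℚ Q₂ := Module.finite_of_finrank_pos (by rw [h₂]; norm_num)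
  have hlt : Q₁ < Q₁ ⊔ Q₂ := by
    refine lt_of_le_of_ne le_sup_left fun h => hne ?_
    have hle : Q₂ ≤ Q₁ := h ▸ le_sup_right
    exact (IntermediateField.eq_of_le_of_finrank_eq hle (h₂.trans h₁.symm)).symm
  have hle4 : finrank ℚ ↥(Q₁ ⊔ Q₂) ≤ 4 := by
    have := IntermediateField.finrank_sup_le Q₁ Q₂
    rw [h₁, h₂] at this
    exact this
  have h2dvd : 2 ∣ finrank ℚ ↥(Q₁ ⊔ Q₂) :=
    h₁ ▸ IntermediateField.finrank_dvd_of_le_right (le_sup_left : Q₁ ≤ Q₁ ⊔ Q₂)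
  have hne2 : finrank ℚ ↥(Q₁ ⊔ Q₂) ≠ 2 := fun h =>
    hlt.ne (IntermediateField.eq_of_le_of_finrank_eq hlt.le (h₁.trans h.symm))
  have hpos : 0 < finrank ℚ ↥(Q₁ ⊔ Q₂) := Module.finrank_pos
  obtain ⟨m, hm⟩ := h2dvd
  interval_cases h : finrank ℚ ↥(Q₁ ⊔ Q₂) <;> omega

/-- **A third quadratic subfield lies in the span of two different ones, inside any `L` with `8 ∤ [L : ℚ]`**
(otherwise `Q₁ Q₂ Q₃ ≤ L` would have degree `8`). [cite: Lang2002, VI §1 Cor. 1.6] -/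
theorem le_sup_of_not_eight_dvd {L Q₁ Q₂ Q₃ : IntermediateField ℚ ℂ} [FiniteDimensional ℚ L]
    (h8 : ¬ 8 ∣ finrank ℚ L) (h₁ : finrank ℚ Q₁ = 2) (h₂ : finrank ℚ Q₂ = 2) (h₃ : finrank ℚ Q₃ = 2)
    (hne : Q₁ ≠ Q₂) (hL₁ : Q₁ ≤ L) (hL₂ : Q₂ ≤ L) (hL₃ : Q₃ ≤ L) : Q₃ ≤ Q₁ ⊔ Q₂ := by
  haveI : FiniteDimensional ℚ Q₃ := Module.finite_of_finrank_pos (by rw [h₃]; norm_num)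
  haveI : FiniteDimensional ℚ ↥(Q₁ ⊔ Q₂ ⊔ Q₃) :=
    finiteDimensional_of_le₄₆ (sup_le (sup_le hL₁ hL₂) hL₃ : Q₁ ⊔ Q₂ ⊔ Q₃ ≤ L)
  haveI : FiniteDimensional ℚ ↥(Q₁ ⊔ Q₂) := finiteDimensional_of_le₄₆ (le_sup_left : Q₁ ⊔ Q₂ ≤ Q₁ ⊔ Q₂ ⊔ Q₃)
  have h4 := finrank_sup_eq_four_of_ne h₁ h₂ hne
  by_contra hnot
  have hlt : Q₁ ⊔ Q₂ < Q₁ ⊔ Q₂ ⊔ Q₃ := lt_of_le_of_ne le_sup_left fun h => hnot (h ▸ le_sup_right)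
  have hle8 : finrank ℚ ↥(Q₁ ⊔ Q₂ ⊔ Q₃) ≤ 8 := by
    have := IntermediateField.finrank_sup_le (Q₁ ⊔ Q₂) Q₃
    rw [h4, h₃] at this
    exact this
  have h4dvd : 4 ∣ finrank ℚ ↥(Q₁ ⊔ Q₂ ⊔ Q₃) :=
    h4 ▸ IntermediateField.finrank_dvd_of_le_right (le_sup_left : Q₁ ⊔ Q₂ ≤ Q₁ ⊔ Q₂ ⊔ Q₃)
  have hne4 : finrank ℚ ↥(Q₁ ⊔ Q₂ ⊔ Q₃) ≠ 4 := fun h =>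
    hlt.ne (IntermediateField.eq_of_le_of_finrank_eq hlt.le (h4.trans h.symm))
  have hdvdL : finrank ℚ ↥(Q₁ ⊔ Q₂ ⊔ Q₃) ∣ finrank ℚ L :=
    IntermediateField.finrank_dvd_of_le_right (sup_le (sup_le hL₁ hL₂) hL₃ : Q₁ ⊔ Q₂ ⊔ Q₃ ≤ L)
  have hpos : 0 < finrank ℚ ↥(Q₁ ⊔ Q₂ ⊔ Q₃) := Module.finrank_pos
  obtain ⟨m, hm⟩ := h4dvd
  have h8' : finrank ℚ ↥(Q₁ ⊔ Q₂ ⊔ Q₃) = 8 := by omega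
  exact h8 (h8' ▸ hdvdL)

/-- **At most two imaginary quadratic subfields when `8 ∤ [L : ℚ]`.**  Three conjugation-stable quadratic subfields
`Q₁, Q₂, Q₃ ≤ L ≤ ℂ`, each containing an element moved by complex conjugation: two of them are equal.  In the Galois
quartic field `M = Q₁ Q₂ ⊇ Q₃` every quadratic subfield is the fixed field of a subgroup `{1, g}` of `Gal(M/ℚ)` (order
`4`) with `g ≠ 1`; for an imaginary one `g` is not complex conjugation; two candidates for `g`, three fields.
[cite: Lang2002, VI §1 Thm. 1.1, Thm. 1.8 and Thm. 1.12] -/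
theorem quadratic_eq_or_eq_or_eq_of_not_eight_dvd {L Q₁ Q₂ Q₃ : IntermediateField ℚ ℂ} [FiniteDimensional ℚ L]
    (h8 : ¬ 8 ∣ finrank ℚ L) (h₁ : finrank ℚ Q₁ = 2) (h₂ : finrank ℚ Q₂ = 2) (h₃ : finrank ℚ Q₃ = 2)
    (hi₁ : ∃ z ∈ Q₁, starRingEnd ℂ z ≠ z) (hi₂ : ∃ z ∈ Q₂, starRingEnd ℂ z ≠ z) (hi₃ : ∃ z ∈ Q₃, starRingEnd ℂ z ≠ z)
    (hL₁ : Q₁ ≤ L) (hL₂ : Q₂ ≤ L) (hL₃ : Q₃ ≤ L) : Q₁ = Q₂ ∨ Q₁ = Q₃ ∨ Q₂ = Q₃ := by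
  classical
  by_contra hall
  push Not at hall
  obtain ⟨h12, h13, h23⟩ := hall
  haveI : FiniteDimensional ℚ Q₁ := Module.finite_of_finrank_pos (by rw [h₁]; norm_num)
  haveI : FiniteDimensional ℚ Q₂ := Module.finite_of_finrank_pos (by rw [h₂]; norm_num)
  haveI : FiniteDimensional ℚ Q₃ := Module.finite_of_finrank_pos (by rw [h₃]; norm_num)
  -- `Q₁`, `Q₂` are normal (quadratic), in the instance form carried by `⊔`
  haveI hN₁ : @Normal ℚ ↥Q₁ _ _ (IntermediateField.algebra' Q₁) := by
    letI iQ : Algebra ℚ ↥Q₁ := IntermediateField.algebra' Q₁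
    haveI : Algebra.IsQuadraticExtension ℚ ↥Q₁ := ⟨h₁⟩
    haveI : Algebra.IsSeparable ℚ ↥Q₁ := Algebra.IsAlgebraic.isSeparable_of_perfectField
    haveI : IsGalois ℚ ↥Q₁ := Algebra.IsQuadraticExtension.isGalois ℚ ↥Q₁
    infer_instance
  haveI hN₂ : @Normal ℚ ↥Q₂ _ _ (IntermediateField.algebra' Q₂) := by
    letI iQ : Algebra ℚ ↥Q₂ := IntermediateField.algebra' Q₂
    haveI : Algebra.IsQuadraticExtension ℚ ↥Q₂ := ⟨h₂⟩
    haveI : Algebra.IsSeparable ℚ ↥Q₂ := Algebra.IsAlgebraic.isSeparable_of_perfectField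
    haveI : IsGalois ℚ ↥Q₂ := Algebra.IsQuadraticExtension.isGalois ℚ ↥Q₂
    infer_instance
  -- the quartic Galois field `M = Q₁ Q₂ ⊇ Q₁, Q₂, Q₃`
  set M : IntermediateField ℚ ℂ := Q₁ ⊔ Q₂ with hM_def
  have hM4 : finrank ℚ ↥M = 4 := finrank_sup_eq_four_of_ne h₁ h₂ h12
  haveI : FiniteDimensional ℚ ↥M := Module.finite_of_finrank_pos (by rw [hM4]; norm_num)
  have hQ₁M : Q₁ ≤ M := le_sup_left
  have hQ₂M : Q₂ ≤ M := le_sup_right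
  have hQ₃M : Q₃ ≤ M := le_sup_of_not_eight_dvd h8 h₁ h₂ h₃ h12 hL₁ hL₂ hL₃
  letI iM : Algebra ℚ ↥M := IntermediateField.algebra' M
  haveI hNM : @Normal ℚ ↥M _ _ (IntermediateField.algebra' M) := by rw [hM_def]; infer_instance
  haveI : Algebra.IsSeparable ℚ ↥M := Algebra.IsAlgebraic.isSeparable_of_perfectField
  haveI : IsGalois ℚ ↥M := ⟨⟩
  -- complex conjugation restricted to `M`
  let cQ : ℂ ≃ₐ[ℚ] ℂ := AlgEquiv.ofRingEquiv (f := (starRingAut : ℂ ≃+* ℂ)) fun q => by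
    rw [eq_ratCast]; exact map_ratCast _ q
  let c : ↥M ≃ₐ[ℚ] ↥M := cQ.restrictNormal ↥M
  have hc : ∀ y : ↥M, ((c y : ↥M) : ℂ) = starRingEnd ℂ y := fun y => AlgEquiv.restrictNormal_commutes cQ (↥M) y
  have hcard : Nat.card (↥M ≃ₐ[ℚ] ↥M) = 4 := by rw [IsGalois.card_aut_eq_finrank, hM4]
  -- each `Q_m`, restricted to `M`, has a fixing subgroup `{1, g_m}` with `g_m ∉ {1, c}`
  have key : ∀ (Q : IntermediateField ℚ ℂ) (hQM : Q ≤ M), finrank ℚ Q = 2 → (∃ z ∈ Q, starRingEnd ℂ z ≠ z) →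
      ∃ g : ↥M ≃ₐ[ℚ] ↥M, g ≠ 1 ∧ g ≠ c ∧
        ∀ h : ↥M ≃ₐ[ℚ] ↥M, h ∈ (IntermediateField.restrict hQM).fixingSubgroup ↔ h = 1 ∨ h = g := by
    intro Q hQM hQ2 hQi
    set Q' : IntermediateField ℚ ↥M := IntermediateField.restrict hQM with hQ'_def
    have hQ'2 : finrank ℚ ↥Q' = 2 := by
      rw [← hQ2]
      exact ((IntermediateField.restrict_algEquiv hQM).toLinearEquiv.finrank_eq).symm
    have hQ'M : finrank ↥Q' ↥M = 2 := by
      have htower := Module.finrank_mul_finrank ℚ ↥Q' ↥M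
      rw [hQ'2, hM4] at htower
      omega
    have hH2 : Nat.card (Q'.fixingSubgroup) = 2 := by
      rw [IsGalois.card_fixingSubgroup_eq_finrank, hQ'M]
    -- an element `g ≠ 1` of the fixing subgroup
    obtain ⟨⟨g, hgH⟩, hg1⟩ : ∃ g : Q'.fixingSubgroup, g ≠ 1 := by
      by_contra hno
      push Not at hno
      have : Nat.card (Q'.fixingSubgroup) = 1 := by
        rw [Nat.card_eq_one_iff_exists]
        exact ⟨1, fun g => hno g⟩
      omega
    have hg1' : g ≠ 1 := fun h => hg1 (Subtype.ext h)
    -- the fixing subgroup is `{1, g}`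
    have hmem : ∀ h : ↥M ≃ₐ[ℚ] ↥M, h ∈ Q'.fixingSubgroup ↔ h = 1 ∨ h = g := by
      intro h
      constructor
      · intro hh
        by_contra hne
        push Not at hne
        -- three distinct elements `1, g, h` in a group of order `2`
        have h3 : (3 : ℕ) ≤ Nat.card (Q'.fixingSubgroup) := by
          have hsub : ({1, ⟨g, hgH⟩, ⟨h, hh⟩} : Finset (Q'.fixingSubgroup)).card = 3 := by
            rw [Finset.card_insert_of_notMem, Finset.card_insert_of_notMem, Finset.card_singleton]
            · simp only [Finset.mem_singleton]
              exact fun e => hne.2 (congrArg Subtype.val e).symm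
            · simp only [Finset.mem_insert, Finset.mem_singleton, not_or]
              exact ⟨fun e => hg1 e.symm, fun e => hne.1 (congrArg Subtype.val e).symm⟩
          rw [← hsub, Nat.card_eq_fintype_card]
          exact Finset.card_le_univ _
        omega
      · rintro (rfl | rfl)
        · exact Subgroup.one_mem _
        · exact hgH
    -- `g ≠ c`: `c` moves an element of `Q`
    obtain ⟨z, hzQ, hcz⟩ := hQi
    have hgc : g ≠ c := by
      intro hgc
      have hzfix := (IntermediateField.mem_fixingSubgroup_iff _ _).1 hgH ⟨z, hQM hzQ⟩
        ((IntermediateField.mem_restrict hQM _).2 hzQ)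
      rw [hgc] at hzfix
      exact hcz (by have := congrArg Subtype.val hzfix; rw [hc] at this; exact this)
    exact ⟨g, hg1', hgc, hmem⟩
  obtain ⟨g₁, hg₁1, hg₁c, hH₁⟩ := key Q₁ hQ₁M h₁ hi₁
  obtain ⟨g₂, hg₂1, hg₂c, hH₂⟩ := key Q₂ hQ₂M h₂ hi₂
  obtain ⟨g₃, hg₃1, hg₃c, hH₃⟩ := key Q₃ hQ₃M h₃ hi₃
  -- `c ≠ 1` (it moves `Q₁`), so `g₁, g₂, g₃ ∈ G ∖ {1, c}`, a set of two elements: two of them agree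
  have hc1 : c ≠ 1 := by
    obtain ⟨z, hzQ, hcz⟩ := hi₁
    intro h
    apply hcz
    have := congrArg (fun f : ↥M ≃ₐ[ℚ] ↥M => ((f ⟨z, hQ₁M hzQ⟩ : ↥M) : ℂ)) h
    simp only [AlgEquiv.one_apply] at this
    rw [hc] at this
    exact this
  have hpigeon : g₁ = g₂ ∨ g₁ = g₃ ∨ g₂ = g₃ := by
    by_contra hne
    push Not at hne
    have h5 : ({1, c, g₁, g₂, g₃} : Finset (↥M ≃ₐ[ℚ] ↥M)).card = 5 := by
      rw [Finset.card_insert_of_notMem, Finset.card_insert_of_notMem, Finset.card_insert_of_notMem,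
        Finset.card_insert_of_notMem, Finset.card_singleton]
      · simpa using hne.2.2
      · simpa using ⟨hne.1, hne.2.1⟩
      · simpa using ⟨hg₁c.symm, hg₂c.symm, hg₃c.symm⟩
      · simpa using ⟨hc1.symm, hg₁1.symm, hg₂1.symm, hg₃1.symm⟩
    have hle := Finset.card_le_univ ({1, c, g₁, g₂, g₃} : Finset (↥M ≃ₐ[ℚ] ↥M))
    rw [h5, ← Nat.card_eq_fintype_card, hcard] at hle
    omega
  -- equal generators give equal fixing subgroups, hence equal fields
  have heq : ∀ {Q Q' : IntermediateField ℚ ℂ} (hQ : Q ≤ M) (hQ' : Q' ≤ M) {g : ↥M ≃ₐ[ℚ] ↥M},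
      (∀ h, h ∈ (IntermediateField.restrict hQ).fixingSubgroup ↔ h = 1 ∨ h = g) →
      (∀ h, h ∈ (IntermediateField.restrict hQ').fixingSubgroup ↔ h = 1 ∨ h = g) → Q = Q' := by
    intro Q Q' hQ hQ' g hH hH'
    have hsub : (IntermediateField.restrict hQ).fixingSubgroup = (IntermediateField.restrict hQ').fixingSubgroup := by
      ext h; rw [hH, hH']
    have hres : IntermediateField.restrict hQ = IntermediateField.restrict hQ' := by
      rw [← IsGalois.fixedField_fixingSubgroup (IntermediateField.restrict hQ), hsub,
        IsGalois.fixedField_fixingSubgroup]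
    ext x
    constructor
    · intro hx
      have h1 : (⟨x, hQ hx⟩ : ↥M) ∈ IntermediateField.restrict hQ := (IntermediateField.mem_restrict hQ _).2 hx
      rw [hres] at h1
      exact (IntermediateField.mem_restrict hQ' _).1 h1
    · intro hx
      have h1 : (⟨x, hQ' hx⟩ : ↥M) ∈ IntermediateField.restrict hQ' := (IntermediateField.mem_restrict hQ' _).2 hx
      rw [← hres] at h1
      exact (IntermediateField.mem_restrict hQ _).1 h1
  rcases hpigeon with h | h | h
  · exact h12 (heq hQ₁M hQ₂M hH₁ (h ▸ hH₂))
  · exact h13 (heq hQ₁M hQ₃M hH₁ (h ▸ hH₃))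
  · exact h23 (heq hQ₂M hQ₃M hH₂ (h ▸ hH₃))

end Quadratic

end Literature.NumberTheory.NumberFields

end
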